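import Summits.CriticalPhenomena.CardyFormulaZ2.Theorems.CardyFlipRussoVoronoiHubFromSmirnovOneArmDefs

/-!
# Stub `chainArm_euc_of_noDefSq` of line `moebius-exact-delaunay-dilation-ward`
# (crux `VoronoiHubFromSmirnov`, stmt-CriticalPhenomena-6433, route `CardyFlipRusso`)

**Cutting a hybrid chain arm down to a Euclidean arm across a defect-free sub-annulus**
(re-planned S3b-i, deterministic core; Benjamini–Schramm, *Conformal invariance of Voronoi
percolation*, Comm. Math. Phys. 197 (1998), §4 and §9 (9.1)).

A chain arm for the hybrid adjacency `adjHyb S ℓ E₁ E₂` (`E₂` on pairs touching a switched square,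
`E₁` elsewhere) around `z` from radius `r₀` out to radius `r₂` contains a chain arm for `E₁` across
any sub-annulus `[r₁, r₂']`, `r₀ ≤ r₁ < r₂' ≤ r₂`, provided no square whose centre lies at distance in
`[r₁ - L - ℓ, r₂' + L + ℓ]` from `z` carries a defect pair, `L` being a bound on the length of the
hybrid steps.  Proof: read the chain on `ℕ`; cut it at the LAST index `a ≤ c` within distance `r₁`
of `z`, where `c` is the FIRST index at distance `≥ r₂'` (`Nat.find`, `Nat.findGreatest`).  On the
sub-chain `a, …, c` every consecutive pair has its first point at distance `< r₂'` and its second at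
distance `> r₁`, hence (step bound) both at distance in `(r₁ - L, r₂' + L)`, and the centre of the
first point's square (within `ℓ` of the point: each coordinate is within `ℓ / 2`) at distance in
`[r₁ - L - ℓ, r₂' + L + ℓ]`.  On such a pair the hybrid adjacency gives `E₁ ∨ E₂`, and `E₂ ∧ ¬ E₁`
would make it a defect pair of that square — excluded.  Pure combinatorics and the triangle
inequality; no new definitions.
-/

noncomputable section

namespace Summit.CriticalPhenomena.CardyFormulaZ2.Cruxes.VoronoiHubFromSmirnov.MoebiusExactDelaunayDilationWard

open Set

/-! ### Squares: a point is within `ℓ` of the centre of its square -/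

/-- One coordinate: `x` is within `ℓ / 2` of the midpoint `(⌊x / ℓ⌋ + 1/2) ℓ` of its `ℓ`-cell. -/
theorem abs_sqCentre_coord_sub_le {ℓ : ℝ} (hℓ : 0 < ℓ) (x : ℝ) :
    |((⌊x / ℓ⌋ : ℝ) + 1 / 2) * ℓ - x| ≤ ℓ / 2 := by
  have h1 : (⌊x / ℓ⌋ : ℝ) * ℓ ≤ x := by
    have h := mul_le_mul_of_nonneg_right (Int.floor_le (x / ℓ)) hℓ.le
    rwa [div_mul_cancel₀ x hℓ.ne'] at h
  have h2 : x < ((⌊x / ℓ⌋ : ℝ) + 1) * ℓ := by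
    have h := mul_lt_mul_of_pos_right (Int.lt_floor_add_one (x / ℓ)) hℓ
    rwa [div_mul_cancel₀ x hℓ.ne'] at h
  rw [abs_le]
  constructor <;> nlinarith [h1, h2]

/-- Every point of the plane is within `ℓ` of the centre of its square of side `ℓ`. -/
theorem dist_sqCentre_sqIdx_le {ℓ : ℝ} (hℓ : 0 < ℓ) (p : ℂ) :
    dist (sqCentre ℓ (sqIdx ℓ p)) p ≤ ℓ := by
  rw [Complex.dist_eq]
  refine (Complex.norm_le_abs_re_add_abs_im _).trans ?_
  have hre : |(sqCentre ℓ (sqIdx ℓ p) - p).re| ≤ ℓ / 2 := by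
    simp only [Complex.sub_re, sqCentre, sqIdx]
    exact abs_sqCentre_coord_sub_le hℓ p.re
  have him : |(sqCentre ℓ (sqIdx ℓ p) - p).im| ≤ ℓ / 2 := by
    simp only [Complex.sub_im, sqCentre, sqIdx]
    exact abs_sqCentre_coord_sub_le hℓ p.im
  linarith

/-! ### Cutting a finite sequence of indices -/

/-- **Two cuts.** If `P 0` and `Q N` hold for two incompatible predicates on `ℕ`, then there are
indices `a < c ≤ N` with `P a`, `Q c`, no `P` on `(a, c]` and no `Q` below `c`: `c` is the first
index satisfying `Q` and `a` the last index `≤ c` satisfying `P`. -/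
theorem exists_cut_indices (P Q : ℕ → Prop) (N : ℕ) (h0 : P 0) (hN : Q N)
    (hPQ : ∀ n, P n → ¬ Q n) :
    ∃ a c : ℕ, a < c ∧ c ≤ N ∧ P a ∧ Q c ∧ (∀ k, a < k → k ≤ c → ¬ P k) ∧
      ∀ k, k < c → ¬ Q k := by
  classical
  have hex : ∃ n, Q n := ⟨N, hN⟩
  have hPa : P (Nat.findGreatest P (Nat.find hex)) := Nat.findGreatest_spec (Nat.zero_le _) h0
  refine ⟨Nat.findGreatest P (Nat.find hex), Nat.find hex, ?_, Nat.find_min' hex hN, hPa,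
    Nat.find_spec hex, fun k hk hkc => Nat.findGreatest_is_greatest hk hkc,
    fun k hk => Nat.find_min hex hk⟩
  refine lt_of_le_of_ne (Nat.findGreatest_le _) fun h => ?_
  rw [h] at hPa
  exact hPQ _ hPa (Nat.find_spec hex)

/-! ### Chain arms read on `ℕ` -/

/-- A chain arm, read as an `ℕ`-indexed sequence (frozen at its last point beyond index `N`). -/
theorem natChain_of_chainArm {E : ℂ → ℂ → Prop} {z : ℂ} {r₁ r₂ : ℝ} {K : Set ℂ} {δ : ℝ}
    {b : Set ℂ} (h : ChainArm E z r₁ r₂ K δ b) :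
    ∃ (N : ℕ) (f : ℕ → ℂ), (∀ n, f n ∈ b) ∧ (∀ n, (δ : ℂ) * f n ∈ K) ∧ dist (f 0) z ≤ r₁ ∧
      r₂ ≤ dist (f N) z ∧ ∀ n, n < N → E (f n) (f (n + 1)) := by
  obtain ⟨N, p, hb, hK, h0, hN, hE⟩ := h
  refine ⟨N, fun n => p ⟨min n N, Nat.lt_succ_of_le (min_le_right n N)⟩, fun n => hb _,
    fun n => hK _, ?_, ?_, ?_⟩
  · have e : (⟨min 0 N, Nat.lt_succ_of_le (min_le_right 0 N)⟩ : Fin (N + 1)) = 0 :=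
      Fin.ext (by simp)
    dsimp only
    rw [e]
    exact h0
  · have e : (⟨min N N, Nat.lt_succ_of_le (min_le_right N N)⟩ : Fin (N + 1)) = Fin.last N :=
      Fin.ext (by simp)
    dsimp only
    rw [e]
    exact hN
  · intro n hn
    have e₁ : (⟨min n N, Nat.lt_succ_of_le (min_le_right n N)⟩ : Fin (N + 1)) =
        Fin.castSucc ⟨n, hn⟩ :=
      Fin.ext (by simp [min_eq_left hn.le])
    have e₂ : (⟨min (n + 1) N, Nat.lt_succ_of_le (min_le_right (n + 1) N)⟩ : Fin (N + 1)) =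
        Fin.succ ⟨n, hn⟩ :=
      Fin.ext (by simp [min_eq_left (Nat.succ_le_of_lt hn)])
    dsimp only
    rw [e₁, e₂]
    exact hE ⟨n, hn⟩

/-- Conversely, a segment `a ≤ n ≤ c` of an `ℕ`-indexed sequence of points of `b`, physically in
`K`, starting within `r₁` of `z`, ending at distance `≥ r₂`, with `E`-adjacent consecutive points,
is a chain arm for `E`. -/
theorem chainArm_of_natChain {E : ℂ → ℂ → Prop} {z : ℂ} {r₁ r₂ : ℝ} {K : Set ℂ} {δ : ℝ}
    {b : Set ℂ} (f : ℕ → ℂ) {a c : ℕ} (hac : a ≤ c) (hb : ∀ n, f n ∈ b)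
    (hK : ∀ n, (δ : ℂ) * f n ∈ K) (ha : dist (f a) z ≤ r₁) (hc : r₂ ≤ dist (f c) z)
    (hE : ∀ n, a ≤ n → n < c → E (f n) (f (n + 1))) : ChainArm E z r₁ r₂ K δ b := by
  refine ⟨c - a, fun k => f (a + k), fun k => hb _, fun k => hK _, ?_, ?_, ?_⟩
  · dsimp only
    rw [Fin.val_zero, add_zero]
    exact ha
  · dsimp only
    rw [Fin.val_last, Nat.add_sub_cancel' hac]
    exact hc
  · intro i
    have h := hE (a + i) (Nat.le_add_right a i) (by have := i.isLt; omega)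
    dsimp only
    rw [Fin.val_castSucc, Fin.val_succ, ← add_assoc]
    exact h

/-! ### One hybrid step near no defective square is Euclidean -/

/-- A hybrid-adjacent pair of black nuclei, physically in `K`, whose first point's square carries no
defect pair, is `E₁`-adjacent: the hybrid adjacency gives `E₁` or `E₂`, and `E₂ ∧ ¬ E₁` would be a
defect pair of that square. -/
theorem euc_of_adjHyb_of_not_defSq {S : Set (ℤ × ℤ)} {ℓ : ℝ} {E₁ E₂ : ℂ → ℂ → Prop} {K : Set ℂ}
    {δ : ℝ} {b : Set ℂ} {p q : ℂ} (hp : p ∈ b) (hq : q ∈ b) (hpK : (δ : ℂ) * p ∈ K)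
    (hqK : (δ : ℂ) * q ∈ K) (hadj : adjHyb S ℓ E₁ E₂ p q)
    (hnd : ¬ DefSq E₁ E₂ ℓ (sqIdx ℓ p) K δ b) : E₁ p q := by
  by_contra h1
  by_cases hS : sqIdx ℓ p ∈ S ∨ sqIdx ℓ q ∈ S
  · exact hnd ⟨p, q, hp, hq, hpK, hqK, Or.inl rfl, fun h => h1 (h.2 (hadj.1 hS))⟩
  · exact h1 (hadj.2 hS)

/-! ### The stub -/

/-- **S3b-i, cutting step.** A hybrid chain arm (`adjHyb S ℓ E₁ E₂`: adjacency `E₂` near switched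
squares, `E₁` elsewhere) around `z` from radius `r₀` out to `r₂` contains a EUCLIDEAN (`E₁`) chain
arm across any sub-annulus `[r₁, r₂']`, `r₀ ≤ r₁ < r₂' ≤ r₂`, near which no square is defective:
if hybrid steps between black nuclei physically in `K` have length `≤ L` and no square with centre at
distance in `[r₁ - L - ℓ, r₂' + L + ℓ]` from `z` carries a defect pair, cut the chain at the last
index within `r₁` of `z` before the first index at distance `≥ r₂'`; every step of the piece in
between has both endpoints at distance in `(r₁ - L, r₂' + L)`, so its first square's centre is in
the defect-free range and the step is `E₁` (`euc_of_adjHyb_of_not_defSq`).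
(source: BenjaminiSchramm1998 §4, §9 (9.1), square-by-square telescoping form) -/
theorem chainArm_euc_of_noDefSq : ∀ (S : Set (ℤ × ℤ)) (ℓ L : ℝ) (E₁ E₂ : ℂ → ℂ → Prop) (z : ℂ)
    (r₀ r₁ r₂' r₂ : ℝ) (K : Set ℂ) (δ : ℝ) (b : Set ℂ), 0 < ℓ → 0 ≤ L →
    ChainArm (adjHyb S ℓ E₁ E₂) z r₀ r₂ K δ b → r₀ ≤ r₁ → r₁ < r₂' → r₂' ≤ r₂ →
    (∀ p q : ℂ, p ∈ b → q ∈ b → (δ : ℂ) * p ∈ K → (δ : ℂ) * q ∈ K → adjHyb S ℓ E₁ E₂ p q →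
      dist p q ≤ L) →
    (∀ j : ℤ × ℤ, r₁ - L - ℓ ≤ dist (sqCentre ℓ j) z → dist (sqCentre ℓ j) z ≤ r₂' + L + ℓ →
      ¬ DefSq E₁ E₂ ℓ j K δ b) →
    ChainArm E₁ z r₁ r₂' K δ b := by
  intro S ℓ L E₁ E₂ z r₀ r₁ r₂' r₂ K δ b hℓ hL hArm h01 h12 h22 hStep hNoDef
  obtain ⟨N, f, hb, hK, h0, hN, hE⟩ := natChain_of_chainArm hArm
  obtain ⟨a, c, hac, hcN, haA, hcB, hA, hB⟩ :=
    exists_cut_indices (fun n => dist (f n) z ≤ r₁) (fun n => r₂' ≤ dist (f n) z) N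
      (h0.trans h01) (h22.trans hN) (fun n hn hn' => absurd (hn'.trans hn) (not_le.mpr h12))
  refine chainArm_of_natChain f hac.le hb hK haA hcB fun n han hnc => ?_
  -- the step `f n → f (n + 1)`, `a ≤ n < c`: hybrid-adjacent, short, inside the sub-annulus
  have hadj : adjHyb S ℓ E₁ E₂ (f n) (f (n + 1)) := hE n (lt_of_lt_of_le hnc hcN)
  have hstep : dist (f n) (f (n + 1)) ≤ L := hStep _ _ (hb _) (hb _) (hK _) (hK _) hadj
  have h1 : r₁ < dist (f (n + 1)) z := not_le.mp (hA (n + 1) (Nat.lt_succ_of_le han) hnc)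
  have h2 : dist (f n) z < r₂' := not_le.mp (hB n hnc)
  have h3 : r₁ - L < dist (f n) z := by
    have ht := dist_triangle (f (n + 1)) (f n) z
    rw [dist_comm (f (n + 1)) (f n)] at ht
    linarith
  -- hence the centre of the square of `f n` lies in the defect-free range
  have hcen : dist (sqCentre ℓ (sqIdx ℓ (f n))) (f n) ≤ ℓ := dist_sqCentre_sqIdx_le hℓ (f n)
  have hlow : r₁ - L - ℓ ≤ dist (sqCentre ℓ (sqIdx ℓ (f n))) z := by
    have ht := dist_triangle (f n) (sqCentre ℓ (sqIdx ℓ (f n))) z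
    rw [dist_comm (f n) (sqCentre ℓ (sqIdx ℓ (f n)))] at ht
    linarith
  have hupp : dist (sqCentre ℓ (sqIdx ℓ (f n))) z ≤ r₂' + L + ℓ := by
    have ht := dist_triangle (sqCentre ℓ (sqIdx ℓ (f n))) (f n) z
    linarith
  exact euc_of_adjHyb_of_not_defSq (hb _) (hb _) (hK _) (hK _) hadj (hNoDef _ hlow hupp)

end Summit.CriticalPhenomena.CardyFormulaZ2.Cruxes.VoronoiHubFromSmirnov.MoebiusExactDelaunayDilationWard

end
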